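import Mathlib
import Summits.AtomisticToContinuum.Crystallization.Theses.GappedShellCensus
import Literature.Geometry.DiscreteGeometry.ShellCensusTwelve
import Literature.Geometry.DiscreteGeometry.KissingFanTriangleSets
import Literature.Geometry.DiscreteGeometry.ShellCensusSearchSound
import Literature.Geometry.DiscreteGeometry.ShellCensusSearchRun00
import Literature.Geometry.DiscreteGeometry.ShellCensusSearchRun01
import Literature.Geometry.DiscreteGeometry.ShellCensusSearchRun02
import Literature.Geometry.DiscreteGeometry.ShellCensusSearchRun03
import Literature.Geometry.DiscreteGeometry.ShellCensusSearchRun04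
import Literature.Geometry.DiscreteGeometry.ShellCensusSearchRun05
import Literature.Geometry.DiscreteGeometry.ShellCensusSearchRun06
import Literature.Geometry.DiscreteGeometry.ShellCensusSearchRun07
import Literature.Geometry.DiscreteGeometry.ShellCensusSearchRun08
import Literature.Geometry.DiscreteGeometry.ShellCensusSearchRun09
import Literature.Geometry.DiscreteGeometry.ShellCensusSearchRun10
import Literature.Geometry.DiscreteGeometry.ShellCensusSearchRun11
import Literature.Geometry.DiscreteGeometry.ShellCensusSearchRun12
import Literature.Geometry.DiscreteGeometry.ShellCensusSearchRun13
import Literature.Geometry.DiscreteGeometry.ShellCensusSearchRun14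
import Literature.Geometry.DiscreteGeometry.ShellCensusSearchRun15
import Summits.AtomisticToContinuum.Crystallization.Theorems.GappedShellCensusShellTrichotomyStubFanStruct
import Summits.AtomisticToContinuum.Crystallization.Theorems.GappedShellCensusShellTrichotomyStubFanAngles
import Summits.AtomisticToContinuum.Crystallization.Theorems.GappedShellCensusShellTrichotomyStubKill4T
import Summits.AtomisticToContinuum.Crystallization.Theorems.GappedShellCensusShellTrichotomyStubKill3TQ
import Summits.AtomisticToContinuum.Crystallization.Theorems.GappedShellCensusShellTrichotomyStubKill3T2H
import Summits.AtomisticToContinuum.Crystallization.Theorems.GappedShellCensusShellTrichotomyStubNoAntiprism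

/-!
# Crux `GappedShellCensus.FiveFoldRationingR` (stmt-AtomisticToContinuum-18071), line `Sketch` —
# stub `stub_ffrCensus4` (the degree-four census of a gapped twelve-shell)

An injective twelve-tuple `t` in `ℝ³` with norms in `[0.98, 1.02]`, pairwise distances `≥ 0.98`,
every pair bonded (`≤ 1.02`) or far (`≥ 1.26`), and every label with EXACTLY four bonded
partners, has — after a relabelling `σ` — the cuboctahedral bond graph
(`sqNormInt (fccVec k − fccVec l) = 2`) or the anticuboctahedral one
(`sqNormInt (hcpVec k − hcpVec l) = 18`).

This statement is VERBATIM the theorem `stub_census` of the sibling crux `ShellTrichotomy`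
(stmt-AtomisticToContinuum-18070, line `Sketch`, file
`Summits/AtomisticToContinuum/Crystallization/Cruxes/ShellTrichotomy/Lines/Sketch.lean`), and the
proof below is THEIR proof, re-assembled here from their landed bricks (all credit to that line):

* the dictionary geometry → labelled fan data (`stub_fanStruct`, `stub_fanAngles`, landed files
  `GappedShellCensusShellTrichotomyStubFanStruct/FanAngles.lean`), glued as `ffrC4_fanDict`;
* the three angle kills `stub_kill4T`, `stub_kill3TQ`, `stub_kill3T2H` (landed), glued with the
  finite census into `ffrC4_censusCore`;
* the FINITE CENSUS `ffrC4_censusFinite` (the statement of their stub `stub_censusFinite`): every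
  abstract census frame `ShellCensusSearch.CF` has the conclusion `CF.Concl` — by the landed
  soundness theorem `ShellCensusSearch.concl_of_parts` (`Literature/…/ShellCensusSearchSound.lean`)
  and the sixteen landed parts of the verified growth search
  `ShellCensusSearch.checkPart_eq_true_00 … _15` (`Literature/…/ShellCensusSearchRun00…15.lean`,
  run by `native_decide`, computational lane: the proof of `stub_ffrCensus4` therefore depends on
  `Lean.ofReduceBool`, exactly like `BrittleRungDescentSoftLocalHales.lean`); the three pattern
  graphs `patAdj 0/1/2` of the checker are identified with the `fccVec`/`hcpVec`/antiprism edge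
  lists by `decide` (`ffrC4_patAdj_zero/one/two`);
* the antiprism kill `stub_noAntiprism` (landed).

Helper names carry the prefix `ffrC4_` so as not to collide with the sibling line's own landing.
-- adapted from Cruxes/ShellTrichotomy/Lines/Sketch.lean (sibling line Sketch, stmt-18070)
-/

noncomputable section

namespace Summit.AtomisticToContinuum.Crystallization.Theorems

open Literature.Geometry.DiscreteGeometry Literature.Geometry.DiscreteGeometry.ShellCensus
open Literature.Geometry.DiscreteGeometry.ShellCensusSearch

/-! ## The finite census, assembled from the landed verified search -/

/-- **All sixteen parts of the census run return `true`** (the landed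
`ShellCensusSearchRun00 … 15.lean`, `native_decide`). [folklore] -/
theorem ffrC4_checkPart_all : ∀ i, i < 16 → checkPart 10 16 i 40 = true := by
  intro i hi
  interval_cases i
  · exact checkPart_eq_true_00
  · exact checkPart_eq_true_01
  · exact checkPart_eq_true_02
  · exact checkPart_eq_true_03
  · exact checkPart_eq_true_04
  · exact checkPart_eq_true_05
  · exact checkPart_eq_true_06
  · exact checkPart_eq_true_07
  · exact checkPart_eq_true_08
  · exact checkPart_eq_true_09
  · exact checkPart_eq_true_10
  · exact checkPart_eq_true_11
  · exact checkPart_eq_true_12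
  · exact checkPart_eq_true_13
  · exact checkPart_eq_true_14
  · exact checkPart_eq_true_15

/-- **Every abstract census frame has the conclusion** (`concl_of_parts` of
`ShellCensusSearchSound.lean` with depth `10`, `16` parts, fuel `40`). [folklore] -/
theorem ffrC4_cfConcl (M : CF) : M.Concl :=
  concl_of_parts (depth := 10) (parts := 16) (fuel := 40) (by norm_num) ffrC4_checkPart_all M

/-- The checker's pattern `0` is the labelled cuboctahedral graph of `fccVec`. [folklore] -/
theorem ffrC4_patAdj_zero : ∀ v w : Fin 12, v ≠ w →
    (patAdj 0 v w = true ↔ sqNormInt (fccVec v - fccVec w) = 2) := by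
  decide

/-- The checker's pattern `1` is the labelled anticuboctahedral graph of `hcpVec`. [folklore] -/
theorem ffrC4_patAdj_one : ∀ v w : Fin 12, v ≠ w →
    (patAdj 1 v w = true ↔ sqNormInt (hcpVec v - hcpVec w) = 18) := by
  decide

/-- The checker's pattern `2` is the labelled hexagonal antiprism (explicit 24 pairs). [folklore] -/
theorem ffrC4_patAdj_two : ∀ v w : Fin 12,
    ((min v.val w.val, max v.val w.val) ∈
      ([(0, 1), (1, 2), (2, 3), (3, 4), (4, 5), (0, 5), (6, 7), (7, 8), (8, 9), (9, 10), (10, 11), (6, 11), (0, 6), (1, 7), (2, 8), (3, 9), (4, 10), (5, 11), (1, 6), (2, 7), (3, 8), (4, 9), (5, 10), (0, 11)] : List (ℕ × ℕ)) ↔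
    (v ≠ w ∧ patAdj 2 v w = true)) := by
  decide

/-- **Finite census** (the statement of the sibling stub `stub_censusFinite`, stmt-18070): a closed
fan surface `tri` on twelve labels (twenty 3-sets, two triangles per side, single-cycle links) with a
4-regular `bond` graph whose edges are sides and whose 3-cliques are triangles, and with no label
whose star is `4T`, `3T+Q` or `3T+2H`, has — up to a relabelling — the cuboctahedral, the
anticuboctahedral or the hexagonal-antiprism bond graph.  By `ffrC4_cfConcl` on the frame built from
the hypotheses. [folklore] -/
theorem ffrC4_censusFinite (bond : Fin 12 → Fin 12 → Bool) (tri : Finset (Finset (Fin 12)))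
    (bond_symm : ∀ v w, bond v w = bond w v) (bond_irrefl : ∀ v, bond v v = false)
    (bond_four : ∀ v, (Finset.univ.filter fun w => bond v w = true).card = 4)
    (tri_card : ∀ S ∈ tri, S.card = 3) (card_tri : tri.card = 20)
    (two_per_side : ∀ S ∈ tri, ∀ s ⊆ S, s.card = 2 → (tri.filter fun S' => s ⊆ S').card = 2)
    (bond_side : ∀ v w, bond v w = true → (tri.filter fun S' => ({v, w} : Finset (Fin 12)) ⊆ S').card = 2)
    (bond_tri : ∀ a b c, a ≠ b → b ≠ c → a ≠ c → bond a b = true → bond b c = true → bond a c = true →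
      ({a, b, c} : Finset (Fin 12)) ∈ tri)
    (link : ∀ v, ∀ A ⊆ tri.filter (fun S => v ∈ S), A.Nonempty →
      (∀ S ∈ A, ∀ S' ∈ tri, v ∈ S' → (S ∩ S').card = 2 → S' ∈ A) → A = tri.filter fun S => v ∈ S)
    (noFourT : ∀ v a b c d : Fin 12,
      (tri.filter fun S => v ∈ S) = {{v, a, b}, {v, b, c}, {v, c, d}, {v, d, a}} →
      bond v a = true → bond v b = true → bond v c = true → bond v d = true →
      bond a b = true → bond b c = true → bond c d = true → bond d a = true → False)
    (noThreeTQ : ∀ v a b c d x : Fin 12,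
      (tri.filter fun S => v ∈ S) = {{v, a, b}, {v, b, c}, {v, c, d}, {v, d, a}} →
      bond v a = true → bond v b = true → bond v c = true → bond v d = true →
      bond a b = true → bond b c = true → bond c d = true → bond d a = false → d ≠ a →
      bond d x = true → bond x a = true → bond v x = false → x ≠ v → False)
    (noThreeTHH : ∀ v a b c d x : Fin 12,
      (tri.filter fun S => v ∈ S) = {{v, a, b}, {v, b, c}, {v, c, d}, {v, d, x}, {v, a, x}} →
      bond v a = true → bond v b = true → bond v c = true → bond v d = true →
      bond a b = true → bond b c = true → bond c d = true → bond d x = true → bond a x = true →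
      bond v x = false → v ≠ x → False) :
    ∃ σ : Equiv.Perm (Fin 12),
      (∀ v w, v ≠ w → (bond (σ v) (σ w) = true ↔ sqNormInt (fccVec v - fccVec w) = 2)) ∨
      (∀ v w, v ≠ w → (bond (σ v) (σ w) = true ↔ sqNormInt (hcpVec v - hcpVec w) = 18)) ∨
      (∀ v w, bond (σ v) (σ w) = true ↔ (min v.val w.val, max v.val w.val) ∈
        ([(0, 1), (1, 2), (2, 3), (3, 4), (4, 5), (0, 5), (6, 7), (7, 8), (8, 9), (9, 10), (10, 11), (6, 11), (0, 6), (1, 7), (2, 8), (3, 9), (4, 10), (5, 11), (1, 6), (2, 7), (3, 8), (4, 9), (5, 10), (0, 11)] : List (ℕ × ℕ))) := by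
  obtain ⟨σ, i, hi, hC⟩ := ffrC4_cfConcl ⟨bond, tri, bond_symm, bond_irrefl, bond_four, tri_card,
    card_tri, two_per_side, bond_side, bond_tri, link, noFourT, noThreeTQ, noThreeTHH⟩
  refine ⟨σ, ?_⟩
  interval_cases i
  · exact Or.inl fun v w hvw => (hC v w hvw).trans (ffrC4_patAdj_zero v w hvw)
  · exact Or.inr (Or.inl fun v w hvw => (hC v w hvw).trans (ffrC4_patAdj_one v w hvw))
  · refine Or.inr (Or.inr fun v w => ?_)
    rw [ffrC4_patAdj_two v w]
    constructor
    · intro h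
      have hvw : v ≠ w := by
        rintro rfl
        have h0 : bond (σ v) (σ v) = false := bond_irrefl (σ v)
        exact Bool.false_ne_true (h0.symm.trans h)
      exact ⟨hvw, (hC v w hvw).1 h⟩
    · rintro ⟨hvw, h⟩
      exact (hC v w hvw).2 h

/-! ## The glue of the sibling line (adapted from Cruxes/ShellTrichotomy/Lines/Sketch.lean) -/

/-- The hypotheses are invariant under relabelling.
-- adapted from Cruxes/ShellTrichotomy/Lines/Sketch.lean (sibling line Sketch, stmt-18070) -/
theorem ffrC4_hyps_perm (t : Fin 12 → EuclideanSpace ℝ (Fin 3)) (σ : Equiv.Perm (Fin 12))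
    (hn : ∀ k, 1 - 1 / 50 ≤ ‖t k‖ ∧ ‖t k‖ ≤ 1 + 1 / 50)
    (hd : ∀ k l, k ≠ l → 1 - 1 / 50 ≤ dist (t k) (t l) ∧ (dist (t k) (t l) ≤ 1 + 1 / 50 ∨ 63 / 50 ≤ dist (t k) (t l))) :
    (∀ k, 1 - 1 / 50 ≤ ‖(t ∘ σ) k‖ ∧ ‖(t ∘ σ) k‖ ≤ 1 + 1 / 50) ∧
    (∀ k l, k ≠ l → 1 - 1 / 50 ≤ dist ((t ∘ σ) k) ((t ∘ σ) l) ∧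
      (dist ((t ∘ σ) k) ((t ∘ σ) l) ≤ 1 + 1 / 50 ∨ 63 / 50 ≤ dist ((t ∘ σ) k) ((t ∘ σ) l))) :=
  ⟨fun k => hn (σ k), fun k l hkl => hd (σ k) (σ l) (σ.injective.ne hkl)⟩

/-- **Dictionary (geometry → fan data)**, assembled from the landed `stub_fanStruct` and
`stub_fanAngles` of the sibling line.
-- adapted from Cruxes/ShellTrichotomy/Lines/Sketch.lean (sibling line Sketch, stmt-18070) -/
theorem ffrC4_fanDict (t : Fin 12 → EuclideanSpace ℝ (Fin 3)) (hinj : Function.Injective t)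
    (hn : ∀ k, 1 - 1 / 50 ≤ ‖t k‖ ∧ ‖t k‖ ≤ 1 + 1 / 50)
    (hd : ∀ k l, k ≠ l → 1 - 1 / 50 ≤ dist (t k) (t l) ∧ (dist (t k) (t l) ≤ 1 + 1 / 50 ∨ 63 / 50 ≤ dist (t k) (t l)))
    (h4 : ∀ k, (Finset.univ.filter fun l => l ≠ k ∧ dist (t k) (t l) ≤ 1 + 1 / 50).card = 4) :
    ∃ (bond : Fin 12 → Fin 12 → Bool) (tri : Finset (Finset (Fin 12))) (ang : Finset (Fin 12) → Fin 12 → ℝ),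
      (∀ v w, bond v w = true ↔ v ≠ w ∧ dist (t v) (t w) ≤ 1 + 1 / 50) ∧
      (∀ S ∈ tri, S.card = 3) ∧ tri.card = 20 ∧
      (∀ S ∈ tri, ∀ s ⊆ S, s.card = 2 → (tri.filter fun S' => s ⊆ S').card = 2) ∧
      (∀ v w, bond v w = true → (tri.filter fun S' => ({v, w} : Finset (Fin 12)) ⊆ S').card = 2) ∧
      (∀ a b c, a ≠ b → b ≠ c → a ≠ c → bond a b = true → bond b c = true → bond a c = true →
        ({a, b, c} : Finset (Fin 12)) ∈ tri) ∧
      (∀ v, ∀ A ⊆ tri.filter (fun S => v ∈ S), A.Nonempty →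
        (∀ S ∈ A, ∀ S' ∈ tri, v ∈ S' → (S ∩ S').card = 2 → S' ∈ A) → A = tri.filter fun S => v ∈ S) ∧
      (∀ S v, 0 ≤ ang S v) ∧ (∀ S v, v ∉ S → ang S v = 0) ∧ (∀ v, ∑ S ∈ tri, ang S v = 2 * Real.pi) ∧
      (∀ S ∈ tri, (∀ v ∈ S, ∀ w ∈ S, v ≠ w → bond v w = true) → ∀ v ∈ S, ang S v ≤ Real.arccos (1 / 4)) ∧
      (∀ v a x, ({v, a, x} : Finset (Fin 12)) ∈ tri → bond v a = true → bond a x = true → bond v x = false →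
        v ≠ x → ang {v, a, x} v ≤ Real.arccos (807 / 2000)) ∧
      (∀ v d a x, ({v, d, a} : Finset (Fin 12)) ∈ tri → bond v d = true → bond v a = true → bond d a = false →
        d ≠ a → bond d x = true → bond x a = true → bond v x = false → x ≠ v →
        ang {v, d, a} v ≤ 2 * Real.arccos (807 / 2000)) := by
  classical
  obtain ⟨tri_card, card_tri, two_per_side, bond_side, bond_tri, link⟩ :=
    stub_fanStruct t hinj hn hd h4 _ rfl _ rfl _ rfl
  obtain ⟨ang_nonneg, ang_zero, sum_ang, tCorner, hCorner, qCorner⟩ :=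
    stub_fanAngles t hinj hn hd h4 _ rfl _ rfl _ rfl _ rfl
  let bond : Fin 12 → Fin 12 → Bool := fun v w => decide (v ≠ w ∧ dist (t v) (t w) ≤ 1 + 1 / 50)
  have hbond : ∀ v w, bond v w = true ↔ v ≠ w ∧ dist (t v) (t w) ≤ 1 + 1 / 50 := fun v w => by
    simp only [bond, decide_eq_true_eq]
  have hfar : ∀ v w, bond v w = false → v ≠ w → 63 / 50 ≤ dist (t v) (t w) := by
    intro v w h hvw
    have h' : ¬ (v ≠ w ∧ dist (t v) (t w) ≤ 1 + 1 / 50) := fun hh => by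
      rw [(hbond v w).2 hh] at h; exact Bool.noConfusion h
    rcases (hd v w hvw).2 with hle | hge
    · exact absurd ⟨hvw, hle⟩ h'
    · exact hge
  refine ⟨bond, _, _, hbond, tri_card, card_tri, two_per_side, ?_, ?_, link, ang_nonneg, ang_zero,
    sum_ang, ?_, ?_, ?_⟩
  · intro v w h
    exact bond_side v w ((hbond v w).1 h).1 ((hbond v w).1 h).2
  · intro a b c hab hbc hac h1 h2 h3
    exact bond_tri a b c hab hbc hac ((hbond a b).1 h1).2 ((hbond b c).1 h2).2 ((hbond a c).1 h3).2
  · intro S hS hall v hv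
    exact tCorner S hS (fun v hv w hw hvw => ((hbond v w).1 (hall v hv w hw hvw)).2) v hv
  · intro v a x hS h1 h2 h3 hvx
    exact hCorner v a x hS ((hbond v a).1 h1).2 ((hbond a x).1 h2).2 (hfar v x h3 hvx)
  · intro v d a x hS h1 h2 h3 hda h4' h5 h6 hxv
    exact qCorner v d a x hS ((hbond v d).1 h1).2 ((hbond v a).1 h2).2 (hfar d a h3 hda)
      ((hbond d x).1 h4').2 ((hbond x a).1 h5).2 (hfar v x h6 hxv.symm)

/-- **Combinatorial core (fan data → bond graph)**: on abstract fan data the bond graph is, up to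
relabelling, the cuboctahedral, the anticuboctahedral or the hexagonal-antiprism graph — from the
three landed angle kills and the finite census `ffrC4_censusFinite`.
-- adapted from Cruxes/ShellTrichotomy/Lines/Sketch.lean (sibling line Sketch, stmt-18070) -/
theorem ffrC4_censusCore (bond : Fin 12 → Fin 12 → Bool) (tri : Finset (Finset (Fin 12)))
    (ang : Finset (Fin 12) → Fin 12 → ℝ)
    (bond_symm : ∀ v w, bond v w = bond w v) (bond_irrefl : ∀ v, bond v v = false)
    (bond_four : ∀ v, (Finset.univ.filter fun w => bond v w = true).card = 4)
    (tri_card : ∀ S ∈ tri, S.card = 3) (card_tri : tri.card = 20)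
    (two_per_side : ∀ S ∈ tri, ∀ s ⊆ S, s.card = 2 → (tri.filter fun S' => s ⊆ S').card = 2)
    (bond_side : ∀ v w, bond v w = true → (tri.filter fun S' => ({v, w} : Finset (Fin 12)) ⊆ S').card = 2)
    (bond_tri : ∀ a b c, a ≠ b → b ≠ c → a ≠ c → bond a b = true → bond b c = true → bond a c = true →
      ({a, b, c} : Finset (Fin 12)) ∈ tri)
    (link : ∀ v, ∀ A ⊆ tri.filter (fun S => v ∈ S), A.Nonempty →
      (∀ S ∈ A, ∀ S' ∈ tri, v ∈ S' → (S ∩ S').card = 2 → S' ∈ A) → A = tri.filter fun S => v ∈ S)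
    (ang_nonneg : ∀ S v, 0 ≤ ang S v) (ang_zero : ∀ S v, v ∉ S → ang S v = 0)
    (sum_ang : ∀ v, ∑ S ∈ tri, ang S v = 2 * Real.pi)
    (tCorner : ∀ S ∈ tri, (∀ v ∈ S, ∀ w ∈ S, v ≠ w → bond v w = true) → ∀ v ∈ S, ang S v ≤ Real.arccos (1 / 4))
    (hCorner : ∀ v a x, ({v, a, x} : Finset (Fin 12)) ∈ tri → bond v a = true → bond a x = true →
      bond v x = false → v ≠ x → ang {v, a, x} v ≤ Real.arccos (807 / 2000))
    (qCorner : ∀ v d a x, ({v, d, a} : Finset (Fin 12)) ∈ tri → bond v d = true → bond v a = true →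
      bond d a = false → d ≠ a → bond d x = true → bond x a = true → bond v x = false → x ≠ v →
      ang {v, d, a} v ≤ 2 * Real.arccos (807 / 2000)) :
    ∃ σ : Equiv.Perm (Fin 12),
      (∀ v w, v ≠ w → (bond (σ v) (σ w) = true ↔ sqNormInt (fccVec v - fccVec w) = 2)) ∨
      (∀ v w, v ≠ w → (bond (σ v) (σ w) = true ↔ sqNormInt (hcpVec v - hcpVec w) = 18)) ∨
      (∀ v w, bond (σ v) (σ w) = true ↔ (min v.val w.val, max v.val w.val) ∈
        ([(0, 1), (1, 2), (2, 3), (3, 4), (4, 5), (0, 5), (6, 7), (7, 8), (8, 9), (9, 10), (10, 11), (6, 11), (0, 6), (1, 7), (2, 8), (3, 9), (4, 10), (5, 11), (1, 6), (2, 7), (3, 8), (4, 9), (5, 10), (0, 11)] : List (ℕ × ℕ))) := by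
  refine ffrC4_censusFinite bond tri bond_symm bond_irrefl bond_four tri_card card_tri two_per_side
    bond_side bond_tri link ?_ ?_ ?_
  · intro v a b c d hstar hva hvb hvc hvd hab hbc hcd hda
    exact stub_kill4T bond tri ang bond_symm ang_nonneg ang_zero sum_ang tCorner v a b c d hstar
      hva hvb hvc hvd hab hbc hcd hda
  · intro v a b c d x hstar hva hvb hvc hvd hab hbc hcd hda hda' hdx hxa hvx hxv
    exact stub_kill3TQ bond tri ang bond_symm ang_nonneg ang_zero sum_ang tCorner qCorner v a b c d x
      hstar hva hvb hvc hvd hab hbc hcd hda hda' hdx hxa hvx hxv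
  · intro v a b c d x hstar hva hvb hvc hvd hab hbc hcd hdx hax hvx hvx'
    exact stub_kill3T2H bond tri ang bond_symm ang_nonneg ang_zero sum_ang tCorner hCorner v a b c d x
      hstar hva hvb hvc hvd hab hbc hcd hdx hax hvx hvx'

/-! ## The registered stub -/

/-- **Stub L4 (DEGREE-FOUR CENSUS; = `stub_census` of the sibling crux ShellTrichotomy, stmt-…-18070).**
An injective twelve-tuple with norms in `[0.98, 1.02]`, pairwise distances `≥ 0.98` and each pair bonded
(`≤ 1.02`) or far (`≥ 1.26`), in which every point has exactly four bonded partners, has — after a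
relabelling `σ` — the cuboctahedral (`|fccVec k − fccVec l|² = 2`) or the anticuboctahedral
(`|hcpVec k − hcpVec l|² = 18`) bond graph.  Proof: the sibling line's `stub_census` — dictionary
`ffrC4_fanDict`, core `ffrC4_censusCore` (angle kills + the verified finite census), antiprism kill
`stub_noAntiprism`.
-- adapted from Cruxes/ShellTrichotomy/Lines/Sketch.lean (sibling line Sketch, stmt-18070) [folklore] -/
theorem stub_ffrCensus4 :
    ∀ t : Fin 12 → EuclideanSpace ℝ (Fin 3), Function.Injective t →
        (∀ k, 1 - 1 / 50 ≤ ‖t k‖ ∧ ‖t k‖ ≤ 1 + 1 / 50) →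
        (∀ k l, k ≠ l → 1 - 1 / 50 ≤ dist (t k) (t l) ∧ (dist (t k) (t l) ≤ 1 + 1 / 50 ∨ 63 / 50 ≤ dist (t k) (t l))) →
        (∀ k, (Finset.univ.filter fun l => l ≠ k ∧ dist (t k) (t l) ≤ 1 + 1 / 50).card = 4) →
        ∃ σ : Equiv.Perm (Fin 12),
          (∀ k l, k ≠ l → (dist (t (σ k)) (t (σ l)) ≤ 1 + 1 / 50 ↔
            Literature.Geometry.DiscreteGeometry.sqNormInt
              (Literature.Geometry.DiscreteGeometry.ShellCensus.fccVec k -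
                Literature.Geometry.DiscreteGeometry.ShellCensus.fccVec l) = 2)) ∨
          (∀ k l, k ≠ l → (dist (t (σ k)) (t (σ l)) ≤ 1 + 1 / 50 ↔
            Literature.Geometry.DiscreteGeometry.sqNormInt
              (Literature.Geometry.DiscreteGeometry.ShellCensus.hcpVec k -
                Literature.Geometry.DiscreteGeometry.ShellCensus.hcpVec l) = 18)) := by
  intro t hinj hn hd h4
  classical
  obtain ⟨bond, tri, ang, hbond, tri_card, card_tri, two_per_side, bond_side, bond_tri, link,
    ang_nonneg, ang_zero, sum_ang, tCorner, hCorner, qCorner⟩ := ffrC4_fanDict t hinj hn hd h4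
  have bond_symm : ∀ v w, bond v w = bond w v := by
    intro v w
    rcases Bool.eq_false_or_eq_true (bond v w) with h | h <;>
      rcases Bool.eq_false_or_eq_true (bond w v) with h' | h' <;> rw [h, h']
    · exfalso
      have := (hbond v w).1 h
      rw [dist_comm] at this
      exact Bool.eq_false_iff.1 h' |>.elim ((hbond w v).2 ⟨this.1.symm, this.2⟩)
    · exfalso
      have := (hbond w v).1 h'
      rw [dist_comm] at this
      exact Bool.eq_false_iff.1 h |>.elim ((hbond v w).2 ⟨this.1.symm, this.2⟩)
  have bond_irrefl : ∀ v, bond v v = false := fun v =>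
    Bool.eq_false_iff.2 fun h => ((hbond v v).1 h).1 rfl
  have bond_four : ∀ v, (Finset.univ.filter fun w => bond v w = true).card = 4 := by
    intro v
    rw [← h4 v]
    congr 1
    ext w
    simp only [Finset.mem_filter, Finset.mem_univ, true_and, hbond v w, ne_comm]
  obtain ⟨σ, hσ⟩ := ffrC4_censusCore bond tri ang bond_symm bond_irrefl bond_four tri_card card_tri
    two_per_side bond_side bond_tri link ang_nonneg ang_zero sum_ang tCorner hCorner qCorner
  rcases hσ with hfcc | hhcp | hanti
  · refine ⟨σ, Or.inl fun k l hkl => ?_⟩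
    rw [← hfcc k l hkl, hbond]
    exact ⟨fun h => ⟨σ.injective.ne hkl, h⟩, fun h => h.2⟩
  · refine ⟨σ, Or.inr fun k l hkl => ?_⟩
    rw [← hhcp k l hkl, hbond]
    exact ⟨fun h => ⟨σ.injective.ne hkl, h⟩, fun h => h.2⟩
  · exfalso
    obtain ⟨hn', hd'⟩ := ffrC4_hyps_perm t σ hn hd
    refine stub_noAntiprism (t ∘ σ) hn' hd' fun k l hkl => ?_
    rw [← hanti k l, Function.comp_apply, Function.comp_apply, hbond]
    exact ⟨fun h => ⟨σ.injective.ne hkl, h⟩, fun h => h.2⟩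

end Summit.AtomisticToContinuum.Crystallization.Theorems

end
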